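/- Copyright: the b2b-balaban cell (near-miss cell 7), T⁴-continuum fan-out, NE7b swarm leaf 04 (gen 7; road W-RP, sub-row
«W3o» file 2 of 2: the bridge between W3n's column σ-algebras and W3o's reference-box σ-algebra).  Released under the
licence of the surrounding project. -/
import Summits.QuantumFields.BalabanUV.T4Continuum.Support.HistoryRPTowerTemplates
import Summits.QuantumFields.BalabanUV.T4Continuum.Support.HistoryRPTowerColumnSigma

/-!
# History chessboard road: W3n's column σ-algebra under the reference box IS W3o's `towerBox` (W3o, file 2)

Summits-side support leaf of the T⁴-continuum cell (rung (B)+1 on a FINITE torus only; NOT infinite volume, NOT the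
mass gap, NOT the Clay statement; NOT a proof of the spine estimate NE7b).  Road W-RP (R-OWNER-23-2 ∕ R-OWNER-23-8) of
the swarm claim table `t4/b2b-balaban-t4-ne7b-p1/LEAVES-NE7b.md`, sub-row «W3o» file 2 (journal l.16733 ∕ leaf-07 g5
l.16952: «whoever lands second adds the bridge»), on top of W3o file 1 (`HistoryRPTowerTemplates`: `boxBonds`, `boxAlg`,
`towerBox`) and W3n file 2 (`HistoryRPTowerColumnSigma`, leaf-07 g5: `links`, `under`, `linkAlg`, `colAlg`).  [folklore]
bookkeeping; one DATA def `boxSites`; no `structure`, no `[cite:]` tag, no `Prop`-valued definition (c1), no constant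
(c2∕c6), no exit ∕ socket ∕ `HistoryConstants` file (c3); nothing printed asserted.

WHAT.  `boxSites P j s` (all labels `< s`), `links_boxSites` (W3n's links of the box = W3o's box bonds), `under_boxSites`
(W3n's `under` of the box of side `s` = the box of side `s·L` one level down, standing range), `boxSites_one` (the top box
of side `1` is the one cell `0`), `linkAlg_boxBonds` (rfl), **`colAlg_boxSites`**: `colAlg G k (boxSites P k (M·L^{K−k})) =
towerBox G K M k` for `k ≤ K ≤ m + P.K`, **`colAlg_singleton_zero`**: `colAlg G K {0} = towerBox G K 1 K` — so W3n's
cut-measurability (`colAlg_le_cutPos`, `measurable_cutRefl_colAlg`) and W3o's template transport speak of the same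
σ-algebras.

HONEST SCOPE.  Identification of two bookkeeping definitions of OUR carriers; discharges nothing by itself; NE7b NOT
proved; spine 0∕9.  HONEST DEPENDENCY (cell): continuum YM on T⁴ ⇐ BetaPertH ∧ nine spine estimates (0/9 proved); BetaPertH
⇐ (D1) ∧ (D4) ∧ CAP+tail; G-an2-4 gates asym, D1 and NE2/3/4.  This file changes none of it. -/

open MeasureTheory
open Literature.MathematicalPhysics.QuantumFieldTheory
open Literature.MathematicalPhysics.QuantumFieldTheory.Balaban1983to89
open Summit.QuantumFields.BalabanUV.T4Continuum.HistoryRPTowerLaw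
open Summit.QuantumFields.BalabanUV.T4Continuum.HistoryRPTowerTemplates
open Summit.QuantumFields.BalabanUV.T4Continuum.HistoryRPTowerColumns
open Summit.QuantumFields.BalabanUV.T4Continuum.HistoryRPTowerColumnSigma

namespace Summit.QuantumFields.BalabanUV.T4Continuum.HistoryRPTowerColumnBox

noncomputable section

variable {P : Params} {G : Type*}

/-- **THE BOX SITES of side `s` at level `j`**: all labels `< s`. -/
def boxSites (P : Params) (j s : ℕ) : Finset (Site P j) := Finset.univ.filter fun x => ∀ μ : Fin P.d, (x μ).val < s

/-- membership in `boxSites`. [folklore] -/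
@[simp] theorem mem_boxSites {j s : ℕ} {x : Site P j} : x ∈ boxSites P j s ↔ ∀ μ : Fin P.d, (x μ).val < s := by
  simp [boxSites]

/-- W3n's links of the box sites are W3o's box bonds. [folklore] -/
theorem links_boxSites (j s : ℕ) : links (boxSites P j s) = boxBonds P j s := by
  ext b
  simp only [mem_links, mem_boxSites, mem_boxBonds]
  exact ⟨fun h μ => ⟨h.1 μ, h.2 μ⟩, fun h => ⟨fun μ => (h μ).1, fun μ => (h μ).2⟩⟩

/-- W3n's sites under the box of side `s` are the box of side `s·L` one level down (standing range). [folklore] -/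
theorem under_boxSites {j : ℕ} (hj : j + 1 ≤ P.m + P.K) (s : ℕ) :
    under (boxSites P (j + 1) s) = boxSites P j (s * P.L) := by
  ext x
  simp only [mem_under, mem_boxSites, Site.val_blockOf hj, Nat.div_lt_iff_lt_mul P.L_pos]

/-- the box of side `1` at the top is the one cell `0`. [folklore] -/
theorem boxSites_one (j : ℕ) : boxSites P j 1 = {(0 : Site P j)} := by
  ext x
  simp only [mem_boxSites, Nat.lt_one_iff, ZMod.val_eq_zero, Finset.mem_singleton]
  exact ⟨fun h => funext h, fun h μ => by rw [h]; rfl⟩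

variable [MeasurableSpace G]

/-- W3n's link algebra of the box bonds is W3o's box algebra (both are `piFinset`). [folklore] -/
theorem linkAlg_boxBonds (j s : ℕ) : linkAlg G (boxBonds P j s) = boxAlg G j s := rfl

/-- **BRIDGE**: W3n's column σ-algebra under the reference box of side `M·L^{K−k}` IS W3o's `towerBox G K M k`
(`k ≤ K ≤ m + P.K`; induction on `k` with `under_boxSites`, `links_boxSites`). [folklore] -/
theorem colAlg_boxSites (K M : ℕ) (hK : K ≤ P.m + P.K) :
    ∀ k : ℕ, k ≤ K → colAlg G k (boxSites P k (M * P.L ^ (K - k))) = towerBox G K M k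
  | 0, _ => by rw [colAlg_zero, links_boxSites]
  | k + 1, hk => by
    rw [colAlg_succ, under_boxSites (hk.trans hK), links_boxSites, mul_assoc, ← pow_succ,
      show K - (k + 1) + 1 = K - k by omega, colAlg_boxSites K M hK k (Nat.le_of_succ_le hk)]

/-- … in particular W3n's `colAlg G K {0}` (the column under the one top cell `0`) is W3o's `towerBox G K 1 K`. [folklore] -/
theorem colAlg_singleton_zero (K : ℕ) (hK : K ≤ P.m + P.K) : colAlg G K {(0 : Site P K)} = towerBox G K 1 K := by
  rw [← colAlg_boxSites K 1 hK K le_rfl, Nat.sub_self, pow_zero, mul_one, boxSites_one]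

end

end Summit.QuantumFields.BalabanUV.T4Continuum.HistoryRPTowerColumnBox
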